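import Summits.BirchSwinnertonDyer.BirchSwinnertonDyer.Theorems.RamifiedHeegnerPairLeafUpperMembersOfReadingOptimalOffRows
import Summits.BirchSwinnertonDyer.Rank1Residual.X1.RankZeroPartner
import Literature.NumberTheory.EllipticCurves.IsogenyQuadraticTwistProofs
import Literature.NumberTheory.EllipticCurves.IsogenyVariableChangeProofs
import Literature.NumberTheory.EllipticCurves.IsogenyCompProofs
import HarnessLib

/-!
# Route `RamifiedHeegnerPair`, residual crux U₀ `LeafRankZeroUpperAtThree` (stmt-BirchSwinnertonDyer-26024), line `splitkolyvagin0` —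
# the TWIST-UNIT road: U₀ WITHOUT the deciding member L₁ and WITHOUT L₀ (mirror of `…LeafRankOneUpperAtThreeTwistUnit.lean`)

HONEST FRAMING. Theorems only; helper file (`--supports stmt-BirchSwinnertonDyer-26024`); nothing is booked, no item is
closed, BSD is not proved for any curve; CONDITIONAL on every displayed input. Lead prover bsd-line-rhp-p2 g7, 2026-08-28.

WHY. The registered composition of U₀'s line (skeleton v5; `…LeafRankZeroUpperAtThreeOptimalMember` §5₀) consumes the route's
DECIDING member L₁ = `Gss2LowerAtThreeRankOne` (item 26021) at ONE place — the LOWER half of the rank-ONE twist `E^{(d_K)}` that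
separates `ord₃ #Ш(E)` from Kolyvagin's bound on `Ш(E/K)[3^∞]` — and the member L₀ = `Gss2LowerAtThreeRankZero` (26023) only for
the rationality of `#Ш_an(E)`. This couples U₀ to L₁; on the 98 `3Nn` rank-one rows rhp-p1's reduction of NT (27201) consumes U₀
at the rank-zero twist (p625317 §10), whence the «member separation» CIRCLE L₁|3Nn ↔ U₀|3Nn (IRREDUCIBLE-ROAD §6, pen 10:56Z).
Both inputs are replaced here: the rank-one twist's lower half by a CHOICE of Heegner field whose rank-one twist has `3`-unit
analytic `Ш` (the tree's twist-unit lever, rank-zero orientation; the unit at ANY member's twist transports by Cassels' invariance),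
and the rationality of `L(E,1)/Ω_E` by modular symbols (`X1.RankZeroPartner.exists_rat_entireLFunction_one_div_realPeriodRat`, from
the parametrisation datum in PUB₀⁺). The rank-zero-side twist-unit datum TU₀(W) is spelled INLINE (the door's `TwistUnitFieldAt`
asks `L(W^{(d_K)},1) ≠ 0`; here the twist has a SIMPLE zero):
  ∃ K imaginary quadratic, `d_K` odd, Heegner for `N_W`, `L(W^{(d_K)},1) = 0 ≠ L′(W^{(d_K)},1)`, and a member `W₂ ∼ W` with a globally
  minimal model `W₂d` of `W₂^{(d_K)}` and `#Ш_an(W₂d) = q`, `ord₃ q ≤ 0`.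

* §1 `leafRankZeroUpper_three_of_sigmaAtDatum_of_twistUnitZero` — U₀ AT `W` from Σ₀ AT ONE DATUM over the twist-unit field: the
  data-level composition `leafRankZeroUpper_three_of_sigmaAtDatum_of_lowerRankOne` (p611715 §2) with (Bump–Friedberg–Hoffstein, L₁,
  L₀-rationality) ↦ (Cassels, TU₀(W), modular-symbol rationality).
* §2 `leafRankZeroUpper_three_tamFree_of_print_of_twistUnitZero` — the TAMAGAWA-FREE rank-zero rows: U₀ at `W` ⟸ printed facts + TU₀(W).
  NO S2, NO Σ, NO L₁, NO L₀, image-free.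
* §3 `leafRankZeroUpper_three_monoCarrier_of_divisibilityReading_of_twistUnitZero` — the mono-multiplicative-carrier rows: print +
  S2 (item 27492 BY NAME) + TU₀(W).
* §4 `leafRankZeroUpper_three_of_latticeOptimal_of_divisibilityReading_of_sigmaStar_of_twistUnitZero` — at a lattice-optimal
  member: print⁺ + S2 + Σ★″ (item 27493 BY NAME) + TU₀(W).
* §5 `leafRankZeroUpperAtThree_of_pubManin_of_divisibilityReading_of_sigmaStar_of_twistUnitZero` — the route decl
  `LeafRankZeroUpperAtThree` BY NAME from PUB₀⁺ ∧ S2 ∧ Σ★″ ∧ TU₀ (:= ∀ non-CM leaf curves of analytic rank `0`, TU₀(W)).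

WHAT THIS SAYS (for the pen and rhp-p1; numbers, not adjectives). Modulo print, U₀ ⟸ S2 ∧ Σ★″ ∧ TU₀ — neither L₁ nor L₀ enters;
with the sibling file, U₁ ⟸ S2 ∧ Σ★″ ∧ TU₁. Hence NT (27201) ⟸ STRUCT ∧ A₃ₙₙ ∧ S2 ∧ Σ★″ ∧ TU₀ by p625317 §10 WITHOUT the circle
through L₁. TU₀ is NOT print (no mod-3 non-vanishing / unit theorem for quadratic twists at an additive 3); per class it is an exact
finite certificate (one Heegner `d` with `r_an(E^{(d)}) = 1` and `3 ∤ #Ш_an(E^{(d)})`, the latter by the Heegner index against the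
modular-symbol value of `L(E,1)/Ω`). BSD is not proved; U₀, L₁, L₀, TU₀ are OPEN.

References: [cite: MilneADT2006, Thm. I.7.3 and Remark I.7.4] [cite: Cassels1965ArithmeticVIII] [cite: Miller2011LMS, §1 and Def. 1.1]
[cite: GrossZagier1986, Thm. I.(6.3), I.(6.5), V.§2] [cite: CastellaGrossiLeeSkinner2022, proof of Thm. 5.3.1, display (5.6)]
[cite: MatarNekovar2019, Thm. 0.7 (p. 456) and §0.11 (p. 457)] [cite: Jetchev2008, Conj. 1.3, Thm. 1.4, Cor. 1.5 (p. 812)]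
[cite: CremonaAlgorithms1997, §2.8 and §3.9 (p. 87)] [cite: KrizLi2019, Thm. 1.20] [cite: Mazur1978, Cor. 4.1].
-/

-- D-0017: single-problem summit, so `Summit.BirchSwinnertonDyer.BirchSwinnertonDyer.…` repeats a namespace BY DESIGN.
set_option linter.dupNamespace false
set_option autoImplicit false

noncomputable section

open scoped Classical NumberField

open WeierstrassCurve IsDedekindDomain IsDedekindDomain.HeightOneSpectrum NumberField
  Rat.HeightOneSpectrum Literature Literature.NumberTheory.EllipticCurves
  Literature.NumberTheory.EllipticCurves.ModularForms
  Literature.NumberTheory.EllipticCurves.Rank1Residual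
  Literature.NumberTheory.EllipticCurves.Rank1Residual.Typed
  Literature.NumberTheory.EllipticCurves.KrizLi2019
  Literature.NumberTheory.QuadraticFields
  Summit.BirchSwinnertonDyer.Rank1Residual
  Summit.BirchSwinnertonDyer.Rank1Residual.Additive
  Summit.BirchSwinnertonDyer.Rank1Residual.X11b.Three
  Summit.BirchSwinnertonDyer.BirchSwinnertonDyer.Theses.RamifiedHeegnerPair
  Summit.BirchSwinnertonDyer.BirchSwinnertonDyer.Theorems
  Summit.BirchSwinnertonDyer.BirchSwinnertonDyer.Theorems.SchneiderFree

namespace Summit.BirchSwinnertonDyer.BirchSwinnertonDyer.Theorems.RamifiedPairUpperBound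

/-! ## §1 One datum: U₀ at `W` from Σ₀ at the datum over the TWIST-UNIT field (no L₁, no L₀) -/

/-- **U₀ AT `W` from Σ₀ AT ONE PARAMETRISATION DATUM over the twist-unit field — L₁-FREE and L₀-FREE.** For a non-CM leaf curve `W`
(`Addv W 3`, `SubGss W 3`) of analytic rank `0`, a parametrisation datum `Dt` at level `N_E`, and the rank-zero-side twist-unit datum
TU₀(W) (`hTU`: a Heegner field `K` of odd discriminant with `L(W^{(d_K)}, s)` vanishing simply at `s = 1` and a member `W₂ ∼ W` whose
twist model `W₂d` has `#Ш_an(W₂d) = q`, `ord₃ q ≤ 0`): IF Σ₀ holds at `Dt` (`hSig`: for every imaginary quadratic `K′` of odd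
discriminant, Heegner for `N_E`, with a simple zero of the twisted `L` at `1`, every Heegner datum, `ι`, and the (non-torsion) Heegner
point, the derived points are `3^{s′}`-divisible for all `s′ ≤ ord₃ ∏c_ℓ(W) + v₃(c(Dt))`), THEN `Typed.MissingUpperBoundAt W 3` — given
the printed facts `hGZ hKo hGZK hmod hMN`, Cassels' invariance `hCassels` and the existence of parametrisation data `hmodP` (for
`L(W,1)/Ω_W ∈ ℚ` by modular symbols). Proof = p611715 §2 with: the Bump–Friedberg–Hoffstein field ↦ the twist-unit field; the twist
model `Cd • W^{(d_K)}` (a leaf curve of analytic rank one, `leaf_twist_of_heegner`) is `ℚ`-isogenous to `W₂d` (twisting commutes with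
isogenies), so its lower half follows from the unit by Cassels + GZK + Version L (`missingLowerBoundAt_of_isIsogenous_of_analyticRank_
le_one`) instead of L₁; the orientation-free receptacle `upper_of_globalDivisibility_of_irreducible`, the rank-zero joint bookkeeping
`jointUpperBoundAt_three_of_indexUpper_rankZero`, and `missingUpperBoundAt_of_jointUpper_of_lower`. CONDITIONAL on every displayed
input; nothing asserted about any curve. [cite: CastellaGrossiLeeSkinner2022, proof of Thm. 5.3.1, display (5.6)]
[cite: MatarNekovar2019, Thm. 0.7 (p. 456) and §0.11 (p. 457)] [cite: MilneADT2006, Thm. I.7.3] [cite: CremonaAlgorithms1997, §3.9 (p. 87)]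
[cite: Jetchev2008, Conj. 1.3] [cite: Miller2011LMS, Def. 1.1] -/
theorem leafRankZeroUpper_three_of_sigmaAtDatum_of_twistUnitZero
    (hGZ : ∀ (N : ℕ) [NeZero N] (W : WeierstrassCurve ℚ) (K : Type) [Field K] [NumberField K],
      gross_zagier N W K)
    (hKo : ∀ (N : ℕ) [NeZero N] (W : WeierstrassCurve ℚ) (K : Type) [Field K] [NumberField K],
      kolyvagin N W K)
    (hGZK : rank_eq_analyticRank_of_analyticRank_le_one) (hmod : hasEntireLFunction_rat)
    (hMN : MatarNekovar2019.thm07_padicValNat_card_sha_primary_add_le_of_globalDivisibility_of_irreducible)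
    (hCassels : bsdRHS_eq_of_isIsogenous) (hmodP : nonempty_modularParametrizationData)
    (W : WeierstrassCurve ℚ) [W.IsElliptic] [W.IsGloballyMinimal] [NeZero (W.conductorNorm ℤ)]
    (hCM : ¬ W.HasCM) (hadd : Addv W 3) (hsub : SubGss W 3) (hr : W.analyticRank = 0)
    (Dt : ModularParametrizationData W (W.conductorNorm ℤ))
    (hTU : ∃ (K : Type) (_ : Field K) (_ : NumberField K) (W₂ W₂d : WeierstrassCurve ℚ) (_ : W₂.IsElliptic)
      (_ : W₂.IsGloballyMinimal) (_ : W₂d.IsElliptic) (_ : W₂d.IsGloballyMinimal),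
      IsImaginaryQuadratic K ∧ Odd (NumberField.discr K) ∧ SatisfiesHeegnerHypothesis (W.conductorNorm ℤ) K ∧
      (W.quadraticTwist (NumberField.discr K : ℚ)).entireLFunction 1 = 0 ∧
      deriv (W.quadraticTwist (NumberField.discr K : ℚ)).entireLFunction 1 ≠ 0 ∧
      IsIsogenous W W₂ ∧ (∃ C : VariableChange ℚ, C • W₂.quadraticTwist (NumberField.discr K : ℚ) = W₂d) ∧
      ∃ qd : ℚ, shaAn W₂d = (qd : ℂ) ∧ padicValRat 3 qd ≤ 0)
    (hSig : ∀ (K : Type) [Field K] [NumberField K]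
      (H : HeegnerDatum (W.conductorNorm ℤ) (NumberField.discr K)) (ι : K →+* ℂ) (P : (W.baseChange K).toAffine.Point),
      IsImaginaryQuadratic K → SatisfiesHeegnerHypothesis (W.conductorNorm ℤ) K →
      (W.quadraticTwist (NumberField.discr K : ℚ)).entireLFunction 1 = 0 →
      deriv (W.quadraticTwist (NumberField.discr K : ℚ)).entireLFunction 1 ≠ 0 →
      WeierstrassCurve.Affine.Point.map ι.toRatAlgHom P = heegnerPointComplex Dt H → ¬ IsOfFinAddOrder P →
      Odd (NumberField.discr K) →
      ∀ (s' : ℕ), s' ≤ padicValNat 3 W.tamagawaProduct + padicValNat 3 Dt.c.natAbs →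
      ∀ (n : ℕ) (d : KolyvaginHeegnerData Dt H.β ι n), Squarefree n →
      (∀ ℓ ∈ n.primeFactors, Zhang2014.IsKolyvaginPrime (W.conductorNorm ℤ) W K 3 ℓ ∧
        s' ≤ Zhang2014.kolyvaginIndex W 3 ℓ) → Koly.PDiv d 3 s') :
    MissingUpperBoundAt W 3 := by
  have hirr : W.HasIrreducibleModPGaloisRep 3 := (classX4_three_of_addv_of_subGss W hadd hsub).2.2
  have h3N : 3 ∣ W.conductorNorm ℤ :=
    (W.dvd_conductorNorm_iff_not_hasGoodReductionAtPrime 3).mpr (not_good_of_addv W 3 hadd)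
  -- the twist-unit field `K` of `W` and the unit member `W₂ ∼ W` with its twist model `W₂d`
  obtain ⟨K, _, _, W₂, W₂d, _, _, _, _, hK, hodd, hHN, hL0, hLd1, hiso, ⟨C, hC⟩, qd, hqd, hv⟩ := hTU
  have h3 : NumberField.discr K ≠ -3 := by
    intro h
    exact (X11b.Three.not_dvd_discr_and_not_dvd_torsionOrder_of_heegner hK hHN (by decide) h3N).1
      (h ▸ ⟨-1, by norm_num⟩)
  have h4 : NumberField.discr K ≠ -4 := by
    intro h
    rw [h] at hodd
    exact (Int.not_odd_iff_even.mpr ⟨-2, by norm_num⟩) hodd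
  -- the Heegner datum and the `K`-rational Heegner point of `Dt`
  obtain ⟨β, hβ⟩ := exists_dvd_sq_sub_discr_holds (W.conductorNorm ℤ) K hK hHN
  obtain ⟨H, -⟩ := nonempty_heegnerDatum_holds (W.conductorNorm ℤ) K hK hβ
  obtain ⟨ι⟩ : Nonempty (K →+* ℂ) := inferInstance
  obtain ⟨P, hP⟩ := heegnerPointComplex_mem_range_map_holds (W.conductorNorm ℤ) W K hK hHN Dt H ι
  -- a globally minimal model of the twist: a LEAF curve of analytic rank ONE, `ℚ`-isogenous to the unit member's twist model
  have hD0 : (NumberField.discr K : ℚ) ≠ 0 := by exact_mod_cast NumberField.discr_ne_zero K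
  haveI hEt : (W.quadraticTwist (NumberField.discr K : ℚ)).IsElliptic := W.isElliptic_quadraticTwist hD0
  obtain ⟨Cd, hCd⟩ := hasGlobalMinimalModel_rat_holds (W.quadraticTwist (NumberField.discr K : ℚ))
  haveI : (Cd • W.quadraticTwist (NumberField.discr K : ℚ)).IsGloballyMinimal := hCd
  have hrt : (W.quadraticTwist (NumberField.discr K : ℚ)).analyticRank = 1 := by
    have hg : AnalyticAt ℂ (W.quadraticTwist (NumberField.discr K : ℚ)).entireLFunction 1 :=
      ((W.quadraticTwist (NumberField.discr K : ℚ)).differentiable_entireLFunction (hmod _)).analyticAt 1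
    have h1 := hg.analyticOrderAt_eq_one_of_zero_deriv_ne_zero hL0 hLd1
    simp only [WeierstrassCurve.analyticRank, analyticOrderNatAt, h1]
    rfl
  have hrd : (Cd • W.quadraticTwist (NumberField.discr K : ℚ)).analyticRank = 1 := by
    rw [analyticRank_smul]
    exact hrt
  obtain ⟨-, haddd, hsubd, -⟩ := leaf_twist_of_heegner W hCM hadd hsub K hK hHN hodd
    (Cd • W.quadraticTwist (NumberField.discr K : ℚ)) Cd rfl
  have hirrd : (Cd • W.quadraticTwist (NumberField.discr K : ℚ)).HasIrreducibleModPGaloisRep 3 :=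
    (classX4_three_of_addv_of_subGss _ haddd hsubd).2.2
  have hiso_d : IsIsogenous (Cd • W.quadraticTwist (NumberField.discr K : ℚ)) W₂d := by
    rw [← hC]
    exact IsIsogenous.trans' (isIsogenous_of_smul _ Cd)
      (IsIsogenous.trans' (hiso.quadraticTwist hD0) (isIsogenous_smul _ C))
  -- the twist's LOWER half from the unit member (Cassels + GZK + Version L), instead of L₁
  have hlow : MissingLowerBoundAt (Cd • W.quadraticTwist (NumberField.discr K : ℚ)) 3 :=
    missingLowerBoundAt_of_isIsogenous_of_analyticRank_le_one hCassels hGZK hmod (le_of_eq hrd) hiso_d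
      ⟨qd, hqd, hv.trans (by exact_mod_cast Nat.zero_le _)⟩
  -- the Heegner point is non-torsion (`L(E,1)·L′(E^{(d_K)},1) ≠ 0`)
  have hLW : W.entireLFunction 1 ≠ 0 := (W.analyticRank_eq_zero_iff_holds (hmod W)).1 hr
  have hLK : LDerivEK W K ≠ 0 := by
    rw [AdditivePotMult.lDerivEK_eq_mul_deriv W K hmod hL0]
    exact mul_ne_zero hLW hLd1
  have hnt : ¬ IsOfFinAddOrder P :=
    (lDerivEK_ne_zero_iff_not_isOfFinAddOrder W (W.conductorNorm ℤ) K (hGZ _ W K) hK hHN ⟨Dt, H, ι, hP⟩).mp hLK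
  -- Σ₀ at this datum ⟹ the socket (orientation-free receptacle, p607279)
  have hI : Upper.IndexUpperBoundLeAt W 3 K P (padicValNat 3 Dt.c.natAbs) :=
    upper_of_globalDivisibility_of_irreducible hKo hMN W 3 (by decide) hCM hirr K hK h3 h4 hHN Dt H ι P hP hnt
      (fun s' hs' n d hn hℓ ↦ hSig K H ι P hK hHN hL0 hLd1 hP hnt hodd s' hs' n d hn hℓ)
  -- the joint upper half (rationality of `L(W,1)/Ω_W` by modular symbols, of `#Ш_an` of the twist from its lower half)
  obtain ⟨qd', hqd', -⟩ := id hlow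
  have hJ : Upper.JointUpperBoundAt W (Cd • W.quadraticTwist (NumberField.discr K : ℚ)) 3 :=
    jointUpperBoundAt_three_of_indexUpper_rankZero W K Dt H ι P (Cd • W.quadraticTwist (NumberField.discr K : ℚ)) Cd
      (hGZ _ W K) (hKo _ W K) hGZK hmod hK hHN hodd hP rfl h3N hirr hirrd hr hrd
      (X1.RankZeroPartner.exists_rat_entireLFunction_one_div_realPeriodRat hmodP W) ⟨qd', hqd'⟩ hI
  -- the twist-unit lever: the twist's lower half removes the twist
  exact Upper.missingUpperBoundAt_of_jointUpper_of_lower hJ hlow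

/-! ## §2 The Tamagawa-free rank-zero rows: U₀ ⟸ printed facts + TU₀(W) (no S2, no Σ, no L₁, no L₀, image-free) -/

/-- **U₀ on the TAMAGAWA-FREE rank-zero rows from PRINT + TU₀(W) ALONE.** For a non-CM leaf curve `W` of analytic rank `0` with
`3 ∤ ∏_ℓ c_ℓ(W)` and a parametrisation datum at level `N_E` with `3 ∤ c`: the depth of Σ₀ is `0`, so `Typed.MissingUpperBoundAt W 3`
follows from the printed facts (Gross–Zagier ∀, Kolyvagin ∀, GZK, Version L, Matar–Nekovář 2019 Thm. 0.7 irreducible form, Cassels,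
parametrisation data) and TU₀(W). Compared with p611715/p616826 the route items L₁ (26021), L₀ (26023) and Bump–Friedberg–Hoffstein
are GONE. [cite: MatarNekovar2019, Thm. 0.7 (p. 456) and §0.11 (p. 457)] [cite: CastellaGrossiLeeSkinner2022, proof of Thm. 5.3.1, display (5.6)]
[cite: MilneADT2006, Thm. I.7.3] [cite: Miller2011LMS, Def. 1.1] -/
theorem leafRankZeroUpper_three_tamFree_of_print_of_twistUnitZero
    (hGZ : ∀ (N : ℕ) [NeZero N] (W : WeierstrassCurve ℚ) (K : Type) [Field K] [NumberField K],
      gross_zagier N W K)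
    (hKo : ∀ (N : ℕ) [NeZero N] (W : WeierstrassCurve ℚ) (K : Type) [Field K] [NumberField K],
      kolyvagin N W K)
    (hGZK : rank_eq_analyticRank_of_analyticRank_le_one) (hmod : hasEntireLFunction_rat)
    (hMN : MatarNekovar2019.thm07_padicValNat_card_sha_primary_add_le_of_globalDivisibility_of_irreducible)
    (hCassels : bsdRHS_eq_of_isIsogenous) (hmodP : nonempty_modularParametrizationData)
    (W : WeierstrassCurve ℚ) [W.IsElliptic] [W.IsGloballyMinimal] [NeZero (W.conductorNorm ℤ)]
    (hCM : ¬ W.HasCM) (hadd : Addv W 3) (hsub : SubGss W 3) (hr : W.analyticRank = 0)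
    (htam : ¬ 3 ∣ W.tamagawaProduct)
    (Dt : ModularParametrizationData W (W.conductorNorm ℤ)) (hc : ¬ (3 : ℤ) ∣ Dt.c)
    (hTU : ∃ (K : Type) (_ : Field K) (_ : NumberField K) (W₂ W₂d : WeierstrassCurve ℚ) (_ : W₂.IsElliptic)
      (_ : W₂.IsGloballyMinimal) (_ : W₂d.IsElliptic) (_ : W₂d.IsGloballyMinimal),
      IsImaginaryQuadratic K ∧ Odd (NumberField.discr K) ∧ SatisfiesHeegnerHypothesis (W.conductorNorm ℤ) K ∧
      (W.quadraticTwist (NumberField.discr K : ℚ)).entireLFunction 1 = 0 ∧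
      deriv (W.quadraticTwist (NumberField.discr K : ℚ)).entireLFunction 1 ≠ 0 ∧
      IsIsogenous W W₂ ∧ (∃ C : VariableChange ℚ, C • W₂.quadraticTwist (NumberField.discr K : ℚ) = W₂d) ∧
      ∃ qd : ℚ, shaAn W₂d = (qd : ℂ) ∧ padicValRat 3 qd ≤ 0) :
    MissingUpperBoundAt W 3 := by
  have ht0 : padicValNat 3 W.tamagawaProduct = 0 := padicValNat.eq_zero_of_not_dvd htam
  have hc0 : padicValNat 3 Dt.c.natAbs = 0 :=
    padicValNat.eq_zero_of_not_dvd fun h ↦ hc (Int.ofNat_dvd_left.mpr h)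
  refine leafRankZeroUpper_three_of_sigmaAtDatum_of_twistUnitZero hGZ hKo hGZK hmod hMN hCassels hmodP W hCM hadd hsub hr
    Dt hTU ?_
  intro K _ _ H ι P _ _ _ _ _ _ _ s' hs' n d _ _
  have hs0 : s' = 0 := by omega
  subst hs0
  exact koly_pDiv_zero d 3

/-! ## §3 The mono-multiplicative-carrier rank-zero rows: U₀ ⟸ print + S2 + TU₀(W) (no L₁, no L₀) -/

/-- **U₀ AT A RANK-ZERO LEAF CURVE ON A MONO-MULTIPLICATIVE-CARRIER ROW WITH A MANIN-CLEAN DATUM, from S2 and TU₀(W).** Data: `W/ℚ`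
globally minimal, non-CM, leaf Gss2 at `3`, `r_an(W) = 0`; a prime `q ∥ N_E` with `ord₃ ∏_ℓ c_ℓ(E) ≤ ord₃ c_q(E)`; the reading's global
Tamagawa binder; `Dt` at level `N_E` with `3 ∤ c`; TU₀(W). DISPLAYED INPUT `hD` = S2, the route item `JetchevDivisibilityReadingS2` (27492)
BY NAME. Proof: §1 with Σ₀ at `Dt` supplied by p616826 §1 (`sigmaAtDatum_three_of_divisibilityReading_monoCarrier`). CONDITIONAL;
nothing asserted; BSD is not proved. [cite: Jetchev2008, Thm. 1.4 and Cor. 1.5 (p. 812)] [cite: MatarNekovar2019, Thm. 0.7 (p. 456)]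
[cite: CastellaGrossiLeeSkinner2022, proof of Thm. 5.3.1, display (5.6)] [cite: Miller2011LMS, Def. 1.1] -/
theorem leafRankZeroUpper_three_monoCarrier_of_divisibilityReading_of_twistUnitZero
    (hGZ : ∀ (N : ℕ) [NeZero N] (W : WeierstrassCurve ℚ) (K : Type) [Field K] [NumberField K],
      gross_zagier N W K)
    (hKo : ∀ (N : ℕ) [NeZero N] (W : WeierstrassCurve ℚ) (K : Type) [Field K] [NumberField K],
      kolyvagin N W K)
    (hGZK : rank_eq_analyticRank_of_analyticRank_le_one) (hmod : hasEntireLFunction_rat)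
    (hMN : MatarNekovar2019.thm07_padicValNat_card_sha_primary_add_le_of_globalDivisibility_of_irreducible)
    (hCassels : bsdRHS_eq_of_isIsogenous) (hmodP : nonempty_modularParametrizationData) (hD : JetchevDivisibilityReadingS2)
    (W : WeierstrassCurve ℚ) [W.IsElliptic] [W.IsGloballyMinimal] [NeZero (W.conductorNorm ℤ)]
    (hCM : ¬ W.HasCM) (hadd : Addv W 3) (hsub : SubGss W 3) (hr : W.analyticRank = 0)
    (q : ℕ) [Fact q.Prime] (hqN : q ∣ W.conductorNorm ℤ) (hq2 : ¬ q ^ 2 ∣ W.conductorNorm ℤ)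
    (hmono : padicValNat 3 W.tamagawaProduct ≤ padicValNat 3 ((W.baseChange ℚ_[q]).localTamagawaNumber ℤ_[q]))
    (htam : ∀ (q' : ℕ) [Fact q'.Prime], q' ∣ W.conductorNorm ℤ →
      3 ∣ (W.baseChange ℚ_[q']).localTamagawaNumber ℤ_[q'] → ¬ q' ^ 2 ∣ W.conductorNorm ℤ)
    (Dt : ModularParametrizationData W (W.conductorNorm ℤ)) (hc : ¬ (3 : ℤ) ∣ Dt.c)
    (hTU : ∃ (K : Type) (_ : Field K) (_ : NumberField K) (W₂ W₂d : WeierstrassCurve ℚ) (_ : W₂.IsElliptic)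
      (_ : W₂.IsGloballyMinimal) (_ : W₂d.IsElliptic) (_ : W₂d.IsGloballyMinimal),
      IsImaginaryQuadratic K ∧ Odd (NumberField.discr K) ∧ SatisfiesHeegnerHypothesis (W.conductorNorm ℤ) K ∧
      (W.quadraticTwist (NumberField.discr K : ℚ)).entireLFunction 1 = 0 ∧
      deriv (W.quadraticTwist (NumberField.discr K : ℚ)).entireLFunction 1 ≠ 0 ∧
      IsIsogenous W W₂ ∧ (∃ C : VariableChange ℚ, C • W₂.quadraticTwist (NumberField.discr K : ℚ) = W₂d) ∧
      ∃ qd : ℚ, shaAn W₂d = (qd : ℂ) ∧ padicValRat 3 qd ≤ 0) :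
    MissingUpperBoundAt W 3 :=
  leafRankZeroUpper_three_of_sigmaAtDatum_of_twistUnitZero hGZ hKo hGZK hmod hMN hCassels hmodP W hCM hadd hsub hr Dt hTU
    (fun K _ _ H ι P hK hHN _ _ hP hnt hodd s' hs' n d hn hℓ ↦
      sigmaAtDatum_three_of_divisibilityReading_monoCarrier hD W hCM hadd hsub q hqN hq2 hmono htam Dt hc K H ι P hK hHN hP
        hnt hodd s' hs' n d hn hℓ)

/-! ## §4 At a lattice-optimal member: U₀ ⟸ print⁺ + S2 + Σ★″ + TU₀(W) (no Manin clause, no L₁, no L₀) -/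

/-- **U₀ AT A RANK-ZERO LEAF CURVE CARRYING A LATTICE-OPTIMAL DATUM ⟸ print⁺ + S2 + Σ★″ + TU₀(W).** Inputs: the printed facts,
Cassels' invariance, parametrisation data, the three printed Manin facts (Mazur 1978 Cor. 4.1, Abbes–Ullmo 1996 Thm. A, Česnavičius
2018 Thm. 1.2) and modularity (newform) for `3 ∤ c` at a lattice-optimal datum of a leaf curve; S2 = item 27492 BY NAME; Σ★″ = item
27493 BY NAME (weakened to the rank-zero orientation at the point of use, `sigmaZeroOptOffRows_of_sigmaStarOptOffRows`); TU₀(W).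
Case split on the row predicate as p621612 §4₀: ON the row §3, OFF the row §1. CONDITIONAL; nothing asserted.
[cite: Jetchev2008, Conj. 1.3, Thm. 1.4 (p. 812)] [cite: MatarNekovar2019, Thm. 0.7 (p. 456)] [cite: Mazur1978, Cor. 4.1]
[cite: Stevens1989, Lemmas (5.2), (5.4)] [cite: CastellaGrossiLeeSkinner2022, proof of Thm. 5.3.1, display (5.6)] [cite: Miller2011LMS, Def. 1.1] -/
theorem leafRankZeroUpper_three_of_latticeOptimal_of_divisibilityReading_of_sigmaStar_of_twistUnitZero
    (hGZ : ∀ (N : ℕ) [NeZero N] (W : WeierstrassCurve ℚ) (K : Type) [Field K] [NumberField K],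
      gross_zagier N W K)
    (hKo : ∀ (N : ℕ) [NeZero N] (W : WeierstrassCurve ℚ) (K : Type) [Field K] [NumberField K],
      kolyvagin N W K)
    (hGZK : rank_eq_analyticRank_of_analyticRank_le_one) (hmod : hasEntireLFunction_rat)
    (hMN : MatarNekovar2019.thm07_padicValNat_card_sha_primary_add_le_of_globalDivisibility_of_irreducible)
    (hnf : exists_isNewformOf) (hCassels : bsdRHS_eq_of_isIsogenous) (hmodP : nonempty_modularParametrizationData)
    (hM : mazur_not_dvd_maninConstant_of_odd) (hAU : abbesUllmo_not_dvd_maninConstant_of_not_dvd_level)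
    (hC2 : cesnavicius_not_two_dvd_maninConstant_of_two_dvd_level)
    (hD : JetchevDivisibilityReadingS2) (hStar : LeafSigmaStarDivisibilityAtThreeOptimalOffRows)
    (W : WeierstrassCurve ℚ) [W.IsElliptic] [W.IsGloballyMinimal] [NeZero (W.conductorNorm ℤ)]
    (hCM : ¬ W.HasCM) (hadd : Addv W 3) (hsub : SubGss W 3) (hr : W.analyticRank = 0)
    (Dt : ModularParametrizationData W (W.conductorNorm ℤ))
    (hopt : ∀ z ∈ Dt.L.lattice, ∃ w ∈ periodLattice Dt.f, z = Dt.c * w)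
    (hTU : ∃ (K : Type) (_ : Field K) (_ : NumberField K) (W₂ W₂d : WeierstrassCurve ℚ) (_ : W₂.IsElliptic)
      (_ : W₂.IsGloballyMinimal) (_ : W₂d.IsElliptic) (_ : W₂d.IsGloballyMinimal),
      IsImaginaryQuadratic K ∧ Odd (NumberField.discr K) ∧ SatisfiesHeegnerHypothesis (W.conductorNorm ℤ) K ∧
      (W.quadraticTwist (NumberField.discr K : ℚ)).entireLFunction 1 = 0 ∧
      deriv (W.quadraticTwist (NumberField.discr K : ℚ)).entireLFunction 1 ≠ 0 ∧
      IsIsogenous W W₂ ∧ (∃ C : VariableChange ℚ, C • W₂.quadraticTwist (NumberField.discr K : ℚ) = W₂d) ∧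
      ∃ qd : ℚ, shaAn W₂d = (qd : ℂ) ∧ padicValRat 3 qd ≤ 0) :
    MissingUpperBoundAt W 3 := by
  by_cases hrow : ((∃ (q : ℕ) (_ : Fact q.Prime), q ∣ W.conductorNorm ℤ ∧ ¬ q ^ 2 ∣ W.conductorNorm ℤ ∧
          padicValNat 3 W.tamagawaProduct ≤ padicValNat 3 ((W.baseChange ℚ_[q]).localTamagawaNumber ℤ_[q])) ∧
        (∀ (q' : ℕ) [Fact q'.Prime], q' ∣ W.conductorNorm ℤ →
          3 ∣ (W.baseChange ℚ_[q']).localTamagawaNumber ℤ_[q'] → ¬ q' ^ 2 ∣ W.conductorNorm ℤ))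
  · obtain ⟨⟨q, _, hqN, hq2, hmono⟩, htam⟩ := hrow
    exact leafRankZeroUpper_three_monoCarrier_of_divisibilityReading_of_twistUnitZero hGZ hKo hGZK hmod hMN hCassels hmodP hD W
      hCM hadd hsub hr q hqN hq2 hmono htam Dt (not_three_dvd_c_of_latticeOptimal_of_subGss hM hAU hC2 hnf W Dt hopt hadd hsub)
      hTU
  · exact leafRankZeroUpper_three_of_sigmaAtDatum_of_twistUnitZero hGZ hKo hGZK hmod hMN hCassels hmodP W hCM hadd hsub hr Dt
      hTU (fun K _ _ H ι P hK hHN hL0' hLd1 hP hnt hodd s' hs' n d hn hℓ ↦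
        sigmaZeroOptOffRows_of_sigmaStarOptOffRows hStar W (W.conductorNorm ℤ) K Dt H ι P hCM hadd hsub hr rfl hopt hrow hK
          hHN hL0' hLd1 hP hnt hodd s' hs' n d hn hℓ)

/-! ## §5 The class statement BY NAME: `LeafRankZeroUpperAtThree` ⟸ PUB₀⁺ ∧ S2 ∧ Σ★″ ∧ TU₀ -/

/-- **`LeafRankZeroUpperAtThree` (item 26024) BY NAME ⟸ PUB₀⁺ ∧ S2 (27492) ∧ Σ★″ (27493) ∧ TU₀**, where PUB₀⁺ is the registered print
conjunction of skeleton `splitkolyvagin0` v5 VERBATIM (its Bump–Friedberg–Hoffstein conjunct is now idle) and TU₀ — the twist-unit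
supply on the rank-ZERO leaf — is spelled inline: every non-CM leaf curve (`Addv W 3`, `SubGss W 3`) of analytic rank `0` carries the
rank-zero-side twist-unit datum TU₀(W). NEITHER L₁ (26021) NOR L₀ (26023) is a hypothesis. Proof: optimal member `W₀ ∼ W` (modularity
alone; again a non-CM leaf curve of analytic rank `0`, so TU₀ applies AT `W₀`), U₀ at `W₀` by §4, transport back by Cassels + GZK +
Version L. CONDITIONAL on every displayed input; U₀ stays OPEN; BSD is not proved. [cite: Jetchev2008, Conj. 1.3, Thm. 1.4 (p. 812)]
[cite: MatarNekovar2019, Thm. 0.7 and Thm. 0.3 (p. 456)] [cite: Mazur1978, Cor. 4.1] [cite: MilneADT2006, Thm. I.7.3]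
[cite: CastellaGrossiLeeSkinner2022, proof of Thm. 5.3.1, display (5.6)] [cite: Miller2011LMS, Def. 1.1] -/
theorem leafRankZeroUpperAtThree_of_pubManin_of_divisibilityReading_of_sigmaStar_of_twistUnitZero
    (hpub : (∀ (N : ℕ) [NeZero N] (W : WeierstrassCurve ℚ) (K : Type) [Field K] [NumberField K],
        Literature.NumberTheory.EllipticCurves.gross_zagier N W K) ∧
      (∀ (N : ℕ) [NeZero N] (W : WeierstrassCurve ℚ) (K : Type) [Field K] [NumberField K],
        Literature.NumberTheory.EllipticCurves.kolyvagin N W K) ∧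
      Literature.NumberTheory.EllipticCurves.rank_eq_analyticRank_of_analyticRank_le_one ∧
      WeierstrassCurve.hasEntireLFunction_rat ∧
      Literature.NumberTheory.EllipticCurves.MatarNekovar2019.thm07_padicValNat_card_sha_primary_add_le_of_globalDivisibility_of_irreducible ∧
      Literature.NumberTheory.EllipticCurves.ModularForms.exists_isNewformOf ∧
      Literature.NumberTheory.EllipticCurves.bumpFriedbergHoffstein_exists_heegnerField_split_twist_simpleZero ∧
      Literature.NumberTheory.EllipticCurves.ModularForms.nonempty_modularParametrizationData ∧
      WeierstrassCurve.bsdRHS_eq_of_isIsogenous ∧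
      Literature.NumberTheory.EllipticCurves.ModularForms.mazur_not_dvd_maninConstant_of_odd ∧
      Literature.NumberTheory.EllipticCurves.ModularForms.abbesUllmo_not_dvd_maninConstant_of_not_dvd_level ∧
      Literature.NumberTheory.EllipticCurves.ModularForms.cesnavicius_not_two_dvd_maninConstant_of_two_dvd_level)
    (hD : JetchevDivisibilityReadingS2) (hStar : LeafSigmaStarDivisibilityAtThreeOptimalOffRows)
    (hTU : ∀ (W : WeierstrassCurve ℚ) [W.IsElliptic] [W.IsGloballyMinimal], ¬ W.HasCM →
      Literature.NumberTheory.EllipticCurves.Rank1Residual.Addv W 3 →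
      Summit.BirchSwinnertonDyer.Rank1Residual.Additive.SubGss W 3 → W.analyticRank = 0 →
      ∃ (K : Type) (_ : Field K) (_ : NumberField K) (W₂ W₂d : WeierstrassCurve ℚ) (_ : W₂.IsElliptic)
        (_ : W₂.IsGloballyMinimal) (_ : W₂d.IsElliptic) (_ : W₂d.IsGloballyMinimal),
        IsImaginaryQuadratic K ∧ Odd (NumberField.discr K) ∧ SatisfiesHeegnerHypothesis (W.conductorNorm ℤ) K ∧
        (W.quadraticTwist (NumberField.discr K : ℚ)).entireLFunction 1 = 0 ∧
        deriv (W.quadraticTwist (NumberField.discr K : ℚ)).entireLFunction 1 ≠ 0 ∧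
        IsIsogenous W W₂ ∧ (∃ C : VariableChange ℚ, C • W₂.quadraticTwist (NumberField.discr K : ℚ) = W₂d) ∧
        ∃ qd : ℚ, shaAn W₂d = (qd : ℂ) ∧ padicValRat 3 qd ≤ 0) :
    LeafRankZeroUpperAtThree := by
  intro W _ _ hCM hadd hsub hr
  obtain ⟨hGZ, hKo, hGZK, hmod, hMN, hnf, -, hmodP, hCassels, hM, hAU, hC2⟩ := hpub
  obtain ⟨W₀, hW₀, hW₀', N, hN0, D₀, hiso, hN₀, -, hopt, hCM₀, hadd₀, hsub₀, hr₀⟩ :=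
    exists_optimal_leaf_member hnf W hCM hadd hsub
  haveI := hW₀
  haveI := hW₀'
  haveI := hN0
  have hr₀' : W₀.analyticRank = 0 := hr₀.trans hr
  -- settle U₀ at the optimal member `W₀`, where TU₀ applies
  have h₀ : MissingUpperBoundAt W₀ 3 := by
    subst hN₀
    exact leafRankZeroUpper_three_of_latticeOptimal_of_divisibilityReading_of_sigmaStar_of_twistUnitZero hGZ hKo hGZK hmod hMN
      hnf hCassels hmodP hM hAU hC2 hD hStar W₀ hCM₀ hadd₀ hsub₀ hr₀' D₀ hopt (hTU W₀ hCM₀ hadd₀ hsub₀ hr₀')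
  -- and transport it back along `W ∼ W₀`
  exact missingUpperBoundAt_of_isIsogenous_of_analyticRank_le_one hCassels hGZK hmod (by rw [hr]; exact zero_le_one) hiso h₀

end Summit.BirchSwinnertonDyer.BirchSwinnertonDyer.Theorems.RamifiedPairUpperBound

end
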